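import Summits.Ventures.PackingBounds.Energy.FivePointRieszFourNQuad
import Summits.Ventures.PackingBounds.Energy.FivePointRieszFourGramFacts
import Summits.Ventures.PackingBounds.Energy.GramListQuad
import HarnessLib

/-!
# Riesz `s = 4`, five points, `d = 6`: the explicit Gram form is nonnegative (bridge to the kernel-checked data)

Framing: lottery ticket; floor = certified bounds/negative ranges. Venture `PackingBounds`, cell
`pub-packcert`, energy family E3PT (pub-packcert-energy gen 11; KERNEL-D6 route).

`quad_bridgeR4`: `S · quad_1R4 y = listQuad y yR 0` (structural `simp` over the data rows + `ring` on a
linear combination of the atoms `y i · y j`); with `GramData.listQuad_eq_sum_ent` and the kernel-checked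
`RieszFourD6.gram_nonneg` this gives `quad_1_nonnegR4 : 0 ≤ quad_1R4 y` — the PSD of the `77 × 77` block
WITHOUT a `ring` proof of a Gram factorisation (infeasible at this size).
-/

noncomputable section

namespace Summit.Ventures.PackingBounds.Energy.FivePointRieszFourN

open Summit.Ventures.PackingBounds.Energy.GramData Summit.Ventures.PackingBounds.Energy.RieszFourD6

set_option maxRecDepth 100000 in
set_option maxHeartbeats 400000000 in
/-- The explicit Gram form, scaled by `S`, is the list-structural quadratic form of the integer data `yR`. -/
theorem quad_bridgeR4 (y : ℕ → ℝ) : (scaleS : ℝ) * quad_1R4 y = listQuad y yR 0 := by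
  simp only [listQuad, rowQuad, yR, yR0, yR1, yR2, yR3, yR4, yR5, yR6, yR7, yR8, yR9, yR10, yR11, yR12, yR13, yR14, yR15, yR16, yR17, yR18, yR19, yR20, yR21, yR22, yR23, yR24, yR25, yR26, yR27, yR28, yR29, yR30, yR31, yR32, yR33, yR34, yR35, yR36, yR37, yR38, yR39, yR40, yR41, yR42, yR43, yR44, yR45, yR46, yR47, yR48, yR49, yR50, yR51, yR52, yR53, yR54, yR55, yR56, yR57, yR58, yR59, yR60, yR61, yR62, yR63, yR64, yR65, yR66, yR67, yR68, yR69, yR70, yR71, yR72, yR73, yR74, yR75, yR76, scaleS, Nat.reduceAdd]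
  unfold quad_1R4 quad_1_0R4 quad_1_1R4 quad_1_2R4 quad_1_3R4 quad_1_4R4 quad_1_5R4 quad_1_6R4 quad_1_7R4 quad_1_8R4 quad_1_9R4
  push_cast
  ring

/-- The data table is `77 × 77`. -/
theorem yR_length : yR.length = 77 := by decide

set_option maxRecDepth 100000 in
/-- Every row of the data table has length `77`. -/
theorem yR_row_length : ∀ m, m < 77 → (yR.getD m []).length = 77 := by decide +kernel

/-- **The `77 × 77` Gram block of the certificate is positive semidefinite**: `quad_1R4 y ≥ 0` for every `y`. -/
theorem quad_1_nonnegR4 (y : ℕ → ℝ) : 0 ≤ quad_1R4 y := by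
  have hS : (0 : ℝ) < (scaleS : ℝ) := by unfold scaleS; norm_num
  have h := gram_nonneg (fun i : Fin 77 => y i)
  rw [← listQuad_eq_sum_ent y yR 77 yR_length yR_row_length, ← quad_bridgeR4 y] at h
  exact (mul_nonneg_iff_of_pos_left hS).1 h

end Summit.Ventures.PackingBounds.Energy.FivePointRieszFourN
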